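import Mathlib.NumberTheory.LSeries.Dirichlet
import Mathlib.NumberTheory.LSeries.Convolution
import Mathlib.NumberTheory.ArithmeticFunction.Moebius
import HarnessLib

/-!
# Meyer's global difference representation — proofs, `K = ℚ`: Dirichlet series of gcd-class
# functions are divisible by `ζ`

Topic `NumberTheory/Automorphic`; namespace `Literature.NumberTheory.Automorphic.Meyer`. Sibling
PROOF file (elementary number theory, Mathlib only) for the finite-adelic part of the plan for
`Meyer.spectralRealisation_rat` [Meyer2005, Thm. 5.11].

A Schwartz–Bruhat function on the finite adeles of `ℚ` which is invariant under `Ẑˣ` restricts on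
the positive rationals to (a dilate of) a sequence `a : ℕ → ℂ` that is periodic and depends only
on `gcd(n, M)` for some modulus `M` [Meyer2005, §5.2: `𝒮(𝔸_{∁S})^{𝒪ˣ_{∁S}} ≅ ℂ[K^×/K^×_S]`, the
restricted tensor product of the `𝒮(K_v)^{𝒪_vˣ} ≅ C_c^∞(K_vˣ/𝒪_vˣ)`, Lemma 4.18 / proof of Thm. 5.1].
The Dirichlet series of such a sequence is a Dirichlet polynomial times `ζ` — the `GL₁`-shadow of
the Euler factorisation `Σ = ∏_v (1 - λ_{p_v}^{-1})^{-1}` of Meyer's summation map [Meyer2005,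
Lemma 5.3]:

* `exists_eq_sum_divisors_of_gcd` — Möbius inversion on the divisor lattice of `M`: a gcd-class
  function is `n ↦ ∑_{d ∣ n} c(d)` with `c` supported on the divisors of `M`;
* **`exists_LSeries_eq_dirichletPolynomial_mul_zeta`** — `∑_{n ≥ 1} a(n) n^{-z} =
  (∑_{d ∣ M} c(d) d^{-z}) · ζ(z)` for `Re z > 1`;
* `differentiable_dirichletPolynomial` — the Dirichlet polynomial (over the divisors of `M`) is entire.

Everything is proved; no definitions, no named facts.

## References

* R. Meyer, *On a representation of the idele class group related to primes and zeros of
  L-functions*, Duke Math. J. 127 (2005) = arXiv:math/0311468, §5.2, Lemma 5.3 [Meyer2005].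
-/

noncomputable section

open ArithmeticFunction Complex Finset
open scoped LSeries.notation ArithmeticFunction.Moebius ArithmeticFunction.zeta

namespace Literature.NumberTheory.Automorphic.Meyer

/-- **Möbius inversion on the divisor lattice**: a function `a` on `ℕ` with
`a(n) = a(gcd(n, M))` (`n ≥ 1`) is of the form `a(n) = ∑_{d ∣ n} c(d)` with `c` supported on the
divisors of `M`. [folklore] -/
theorem exists_eq_sum_divisors_of_gcd {M : ℕ} {a : ℕ → ℂ}
    (ha : ∀ n, n ≠ 0 → a n = a (Nat.gcd n M)) :
    ∃ c : ℕ → ℂ, (∀ n, ¬ n ∣ M → c n = 0) ∧ ∀ n, n ≠ 0 → a n = ∑ d ∈ n.divisors, c d := by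
  classical
  -- `A` = `a` as an arithmetic function, `B = A * μ`, `c = B` restricted to the divisors of `M`
  set A : ArithmeticFunction ℂ := toArithmeticFunction a with hA
  set B : ArithmeticFunction ℂ := A * (μ : ArithmeticFunction ℂ) with hB
  refine ⟨fun n => if n ∣ M then B n else 0, fun n hn => if_neg hn, fun n hn => ?_⟩
  have hAB : B * (ζ : ArithmeticFunction ℂ) = A := by
    rw [hB, mul_assoc, coe_moebius_mul_coe_zeta, mul_one]
  -- `∑_{d ∣ n} c d = ∑_{d ∣ gcd(n, M)} B d = (B * ζ)(gcd(n, M)) = A (gcd(n, M)) = a n`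
  have hg0 : Nat.gcd n M ≠ 0 := Nat.gcd_ne_zero_left hn
  calc a n = a (Nat.gcd n M) := ha n hn
    _ = A (Nat.gcd n M) := by rw [hA]; simp [toArithmeticFunction, hg0]
    _ = ∑ d ∈ (Nat.gcd n M).divisors, B d := by rw [← hAB, coe_mul_zeta_apply]
    _ = ∑ d ∈ n.divisors.filter (· ∣ M), B d := by
        refine Finset.sum_congr ?_ fun _ _ => rfl
        ext d
        simp only [Nat.mem_divisors, Finset.mem_filter, Nat.dvd_gcd_iff]
        tauto
    _ = ∑ d ∈ n.divisors, if d ∣ M then B d else 0 := by rw [Finset.sum_filter]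

/-- The L-series of a finitely supported sequence (supported on the divisors of `M`) is the finite
Dirichlet polynomial `∑_{d ∣ M} c(d) d^{-z}`, for every `z`. [folklore] -/
theorem LSeries_eq_sum_divisors {M : ℕ} (hM : M ≠ 0) {c : ℕ → ℂ} (hc : ∀ n, ¬ n ∣ M → c n = 0)
    (z : ℂ) : LSeries c z = ∑ d ∈ M.divisors, c d * (d : ℂ) ^ (-z) := by
  rw [LSeries, tsum_eq_sum (s := M.divisors)]
  · refine Finset.sum_congr rfl fun d hd => ?_
    have hd0 : d ≠ 0 := Nat.ne_of_gt (Nat.pos_of_mem_divisors hd)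
    rw [LSeries.term_of_ne_zero hd0, cpow_neg, div_eq_mul_inv]
  · intro n hn
    rcases eq_or_ne n 0 with rfl | hn0
    · exact LSeries.term_zero _ _
    · rw [LSeries.term_of_ne_zero hn0, hc n (fun h => hn (Nat.mem_divisors.mpr ⟨h, hM⟩)), zero_div]

/-- Such a sequence is `LSeriesSummable` everywhere. [folklore] -/
theorem LSeriesSummable_of_support_divisors {M : ℕ} (hM : M ≠ 0) {c : ℕ → ℂ}
    (hc : ∀ n, ¬ n ∣ M → c n = 0) (z : ℂ) : LSeriesSummable c z := by
  refine summable_of_ne_finset_zero (s := M.divisors) fun n hn => ?_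
  rcases eq_or_ne n 0 with rfl | hn0
  · exact LSeries.term_zero _ _
  · rw [LSeries.term_of_ne_zero hn0, hc n (fun h => hn (Nat.mem_divisors.mpr ⟨h, hM⟩)), zero_div]

/-- **The Dirichlet series of a gcd-class function is a Dirichlet polynomial times `ζ`**: if
`a(n) = a(gcd(n, M))` for `n ≥ 1` then there is `c`, supported on the divisors of `M`, with
`∑_{n ≥ 1} a(n) n^{-z} = (∑_{d ∣ M} c(d) d^{-z}) ζ(z)` for `Re z > 1`. [cite: Meyer2005, Lemma 5.3] -/
theorem exists_LSeries_eq_dirichletPolynomial_mul_zeta {M : ℕ} (hM : M ≠ 0) {a : ℕ → ℂ}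
    (ha : ∀ n, n ≠ 0 → a n = a (Nat.gcd n M)) :
    ∃ c : ℕ → ℂ, (∀ n, ¬ n ∣ M → c n = 0) ∧
      ∀ z : ℂ, 1 < z.re → LSeries a z = (∑ d ∈ M.divisors, c d * (d : ℂ) ^ (-z)) * riemannZeta z := by
  obtain ⟨c, hc, hac⟩ := exists_eq_sum_divisors_of_gcd ha
  refine ⟨c, hc, fun z hz => ?_⟩
  have hconv : ∀ n, n ≠ 0 → a n = (c ⍟ (fun n => ((ζ n : ℕ) : ℂ))) n := by
    intro n hn
    rw [hac n hn, LSeries.convolution_def]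
    simp only
    rw [← Nat.map_div_right_divisors, Finset.sum_map]
    refine Finset.sum_congr rfl fun d hd => ?_
    simp only [Function.Embedding.coeFn_mk]
    have hnd : n / d ≠ 0 := Nat.div_ne_zero_iff_of_dvd (Nat.dvd_of_mem_divisors hd) |>.mpr
      ⟨hn, Nat.ne_of_gt (Nat.pos_of_mem_divisors hd)⟩
    rw [ArithmeticFunction.zeta_apply_ne hnd, Nat.cast_one, mul_one]
  rw [LSeries_congr (fun {n} hn => hconv n hn) z,
    LSeries_convolution' (LSeriesSummable_of_support_divisors hM hc z) (LSeriesSummable_zeta_iff.mpr hz),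
    LSeries_eq_sum_divisors hM hc z, LSeries_zeta_eq_riemannZeta hz]

/-- A Dirichlet polynomial over the divisors of `M` is entire. [folklore] -/
theorem differentiable_dirichletPolynomial (M : ℕ) (c : ℕ → ℂ) :
    Differentiable ℂ fun z : ℂ => ∑ d ∈ M.divisors, c d * (d : ℂ) ^ (-z) := by
  refine Differentiable.fun_sum fun d hd => ?_
  have hd0 : (d : ℂ) ≠ 0 := by exact_mod_cast Nat.ne_of_gt (Nat.pos_of_mem_divisors hd)
  exact (differentiable_const _).mul (differentiable_id.neg.const_cpow (Or.inl hd0))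

end Literature.NumberTheory.Automorphic.Meyer
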